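/-
Copyright (c) 2026 the pub-hodgecm-mathlib formalisation cell (harness21).  Prover seat hodgecm-mathlib-A-p19 (g28): «S3-ram» seeding wave (LEAD F0P3a-plan (g13);
owner F0P3a-p06 (g15); (Cnt2′) chair F0P3a-p07 (g14)), row (z4-i) «the BLOCK FRAME of the opposite literal» — its place-free engine; 2026-09-02.
-/
import Literature.NumberTheory.Automorphic.UnitaryLatticeTreeTypeTwoGram     -- ★ `IsIntMatrix`, `isIntMatrix_mul`, `isIntMatrix_transpose_map`, `v_det_eq_one_of_isIntMatrix_inv`
import Literature.NumberTheory.Automorphic.UnitaryGroupSelfDualLocus         -- ★ `formCongr_hermitian`, `formCongr_mul_eq_formCongr_formCongr` (brings ★ `formCongr`)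
import HarnessLib

/-!
# Unimodular hermitian planes over a discretely valued field with `|2| = 1`: INTEGRAL diagonalisation, and residual anisotropy from a non-norm discriminant
# (Jacobowitz 1962 §4, §7–§8; O'Meara §92:1; Serre, Local Fields V §3)

Topic `NumberTheory/QuadraticForms`; namespace `Literature.NumberTheory.QuadraticForms.HermitianUnimodularValued`.  THEOREMS ONLY (no definition, no instance, no notation, no named
fact, no `sorry`); pure valued-field algebra; kernel lane `--supports stmt-HodgeConjecture-24833`.  Cell `pub/hodgecm-mathlib` (D-0151), crux H413; road «S3-ram», row **(z4-i)** of the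
(Cnt2′) chair's roadmap (F0P3a-p07 (g14), rulings (5)∕(6) 2026-09-02): the engine that re-frames the anisotropic type-(2) literal (★ `Rogawski1990.exists_anisotropicLiteral_ram`) on a
DIAGONAL plane, in the currency `(hd) (hanis₀) (hanis₁)` of ★ `UnitaryLatticeTreeAnisotropicAxisCount`.  The FIELD-LEVEL twin (integrality as valuation bounds `IsIntMatrix E`,
`IsIntMatrix E⁻¹`) of the local-ring engine ★ `QuadraticForms.HermitianUnimodularRamified.exists_formCongr_eq_diagonal`.
HONEST LABEL: HC_CM is proved only modulo the cell's 2 remaining named inputs (hLiu418 24832, h413 24833) until rung 0 closes; nothing printed is asserted here; count-neutral.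

THE MATHEMATICS (`K` a field with a valuation into `ℤₘ₀`, `σ : K →+* K` an isometric involution, `|2| = 1`; `Ψ ∈ M₂(K)` σ-hermitian, integral, `|det Ψ| = 1`).
* §1 `formCongr_two_apply_zero_zero`, `formCongr_upperShear_eq_diagonal` (`(1, −b∕a; 0, 1)` takes `(a b; σb d)` to `diag(a, det∕a)`), `diagonal_map_transpose_of_forall`, `det_formCongr_eq`.
* §2 `exists_isIntMatrix_formCongr_corner_unit` — a unit PIVOT: `E = 1` if `Ψ₀₀` is a unit, the swap if `Ψ₁₁` is, else `b = Ψ₀₁` is a unit and `e₀ + b⁻¹e₁` has length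
  `2 + Ψ₀₀ + Ψ₁₁∕N(b)`, a unit since `|2| = 1`; **`exists_isIntMatrix_formCongr_eq_diagonal`** — `ᵗσ̄E·Ψ·E = diag(d₀, d₁)` with `E, E⁻¹` integral and `dᵢ` σ-fixed units
  (every unimodular hermitian lattice at odd residue characteristic has an orthogonal basis [Jacobowitz1962, §8; Omeara1963, §92:1]).
* §3 `valued_add_mul_norm_eq_one_of_not_norm`, `valued_mul_norm_add_eq_one_of_not_norm` — if `−d₀d₁` is NOT a norm `tσt` then `diag(d₀, d₁)` is RESIDUALLY ANISOTROPIC: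
  `|d₀ + d₁N(c)| = |d₀N(c) + d₁| = 1` for integral `c`, given the clause (norm) «σ-fixed principal units are norms» (else `u = −d₀∕(d₁N(c)) ≡ 1` is a norm `N(z)` and
  `−d₀d₁ = N(z·d₁·c)`) — the general-diagonal form of ★ `UnitaryLatticeTree.anisotropic_diagonal_neg_of_not_norm` (`diag(−ε, 1)`).

## References
* [Jacobowitz1962] R. Jacobowitz, *Hermitian forms over local fields*, Amer. J. Math. 84 (1962), §4, §7 Thm. 7.1, §8.
* [Omeara1963] O. T. O'Meara, *Introduction to Quadratic Forms* (1963), §92:1.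
* [Serre1979] J.-P. Serre, *Local Fields*, GTM 67 (1979), Ch. V §3.
* [LabesseLanglands1979] J.-P. Labesse, R. P. Langlands, *L-indistinguishability for SL(2)*, Canad. J. Math. 31 (1979), §2 p. 9.
-/

set_option autoImplicit false

noncomputable section

open Matrix
open Literature.NumberTheory.Automorphic Literature.NumberTheory.Automorphic.UnitaryGroup Literature.NumberTheory.Automorphic.UnitaryLatticeTree
open scoped MatrixGroups

namespace Literature.NumberTheory.QuadraticForms.HermitianUnimodularValued

/-! ## §1 `2 × 2` bookkeeping over a field -/

section Algebra

variable {K : Type*} [Field K]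

/-- The `(0,0)` entry of `ᵗσ̄E·Ψ·E` for `2 × 2` matrices, expanded. [cite: Jacobowitz1962, §4] -/
theorem formCongr_two_apply_zero_zero (σ : K →+* K) (E : GL (Fin 2) K) (Ψ : Matrix (Fin 2) (Fin 2) K) :
    formCongr σ E Ψ 0 0 =
      σ ((E : Matrix (Fin 2) (Fin 2) K) 0 0) * (Ψ 0 0 * (E : Matrix (Fin 2) (Fin 2) K) 0 0 + Ψ 0 1 * (E : Matrix (Fin 2) (Fin 2) K) 1 0) +
        σ ((E : Matrix (Fin 2) (Fin 2) K) 1 0) * (Ψ 1 0 * (E : Matrix (Fin 2) (Fin 2) K) 0 0 + Ψ 1 1 * (E : Matrix (Fin 2) (Fin 2) K) 1 0) := by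
  simp only [formCongr, Matrix.mul_apply, Fin.sum_univ_two, Matrix.transpose_apply, Matrix.map_apply]
  ring

/-- **The integral shear diagonalises a hermitian plane with non-zero corner**: for `Ψ = (a b; σb d)` with `σa = a ≠ 0` and `E = (1, −b∕a; 0, 1)`,
`ᵗσ̄E·Ψ·E = diag(a, det Ψ∕a)`. [cite: Jacobowitz1962, §4] [cite: Omeara1963, §92:1] -/
theorem formCongr_upperShear_eq_diagonal (σ : K →+* K) {Ψ : Matrix (Fin 2) (Fin 2) K} (h10 : Ψ 1 0 = σ (Ψ 0 1)) (h00 : σ (Ψ 0 0) = Ψ 0 0)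
    (ha : Ψ 0 0 ≠ 0) (E : GL (Fin 2) K) (hE : (E : Matrix (Fin 2) (Fin 2) K) = !![1, -(Ψ 0 1 / Ψ 0 0); 0, 1]) :
    formCongr σ E Ψ = Matrix.diagonal ![Ψ 0 0, Ψ.det / Ψ 0 0] := by
  rw [formCongr, hE, Matrix.det_fin_two]
  ext i j
  fin_cases i <;> fin_cases j <;>
    simp [Matrix.mul_apply, Fin.sum_univ_two, Matrix.transpose_apply, Matrix.map_apply, map_neg, map_div₀, h00, h10]
  all_goals field_simp
  all_goals ring

/-- A diagonal matrix with σ-fixed entries is σ-hermitian. [cite: Jacobowitz1962, §4] -/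
theorem diagonal_map_transpose_of_forall {n : ℕ} (σ : K →+* K) {d : Fin n → K} (hσd : ∀ i, σ (d i) = d i) :
    ((Matrix.diagonal d).map σ)ᵀ = Matrix.diagonal d := by
  rw [Matrix.diagonal_map (map_zero σ), Matrix.diagonal_transpose]
  congr 1
  funext i
  exact hσd i

/-- `det (ᵗσ̄E·Ψ·E) = det Ψ · (det E · σ(det E))`. [cite: Jacobowitz1962, §4] -/
theorem det_formCongr_eq {n : ℕ} (σ : K →+* K) (E : GL (Fin n) K) (Ψ : Matrix (Fin n) (Fin n) K) :
    (formCongr σ E Ψ).det = Ψ.det * ((E : Matrix (Fin n) (Fin n) K).det * σ (E : Matrix (Fin n) (Fin n) K).det) := by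
  rw [formCongr, Matrix.det_mul, Matrix.det_mul, Matrix.det_transpose, ← RingHom.mapMatrix_apply, ← RingHom.map_det]
  ring

end Algebra

/-! ## §2 A unit pivot and the integral diagonalisation; §3 residual anisotropy -/

section ValuedField

variable {K : Type*} [Field K] [Valued K (WithZero (Multiplicative ℤ))]

/-- **A unit pivot**: for a σ-hermitian integral `2 × 2` matrix `Ψ` with `|det Ψ| = 1` and `|2| = 1` (`σ` isometric) there is `E ∈ GL₂` with `E, E⁻¹` integral and
`|(ᵗσ̄E·Ψ·E)₀₀| = 1`: `E = 1` if `Ψ₀₀` is a unit, the swap if `Ψ₁₁` is, and otherwise `b = Ψ₀₁` is a unit and `e₀ + b⁻¹e₁` has length `2 + Ψ₀₀ + Ψ₁₁∕N(b)`, a unit.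
[cite: Jacobowitz1962, §8] [cite: Omeara1963, §92:1] -/
theorem exists_isIntMatrix_formCongr_corner_unit {σ : K →+* K} (hvσ : ∀ a, Valued.v (σ a) = Valued.v a) (h2 : Valued.v (2 : K) = 1)
    {Ψ : Matrix (Fin 2) (Fin 2) K} (hΨh : (Ψ.map σ)ᵀ = Ψ) (hΨint : IsIntMatrix Ψ) (hΨdet : Valued.v Ψ.det = 1) :
    ∃ E : GL (Fin 2) K, IsIntMatrix (E : Matrix (Fin 2) (Fin 2) K) ∧ IsIntMatrix ((E⁻¹ : GL (Fin 2) K) : Matrix (Fin 2) (Fin 2) K) ∧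
      Valued.v (formCongr σ E Ψ 0 0) = 1 := by
  have h10 : Ψ 1 0 = σ (Ψ 0 1) := by
    have h := congr_fun (congr_fun hΨh 1) 0
    rw [Matrix.transpose_apply, Matrix.map_apply] at h
    exact h.symm
  have hint1 : IsIntMatrix (1 : Matrix (Fin 2) (Fin 2) K) := fun i j => by
    rw [Matrix.one_apply]; split_ifs <;> simp
  by_cases h00 : Valued.v (Ψ 0 0) = 1
  · refine ⟨1, by rw [Units.val_one]; exact hint1, by rw [inv_one, Units.val_one]; exact hint1, ?_⟩
    rw [formCongr_two_apply_zero_zero, Units.val_one]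
    simp [h00]
  by_cases h11 : Valued.v (Ψ 1 1) = 1
  · -- the swap
    have hSS : (!![(0 : K), 1; 1, 0] : Matrix (Fin 2) (Fin 2) K) * !![(0 : K), 1; 1, 0] = 1 := by
      ext i j; fin_cases i <;> fin_cases j <;> simp [Matrix.mul_apply, Fin.sum_univ_two]
    have hSint : IsIntMatrix (!![(0 : K), 1; 1, 0] : Matrix (Fin 2) (Fin 2) K) := fun i j => by
      fin_cases i <;> fin_cases j <;> simp
    refine ⟨⟨_, _, hSS, hSS⟩, hSint, hSint, ?_⟩
    rw [formCongr_two_apply_zero_zero]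
    simp [h11]
  -- both diagonal entries are non-units: `b = Ψ 0 1` is a unit
  have h00' : Valued.v (Ψ 0 0) < 1 := lt_of_le_of_ne (hΨint 0 0) h00
  have h11' : Valued.v (Ψ 1 1) < 1 := lt_of_le_of_ne (hΨint 1 1) h11
  have hb : Valued.v (Ψ 0 1) = 1 := by
    by_contra hne
    have hlt : Valued.v (Ψ 0 1) < 1 := lt_of_le_of_ne (hΨint 0 1) hne
    have h : Valued.v Ψ.det < 1 := by
      rw [Matrix.det_fin_two]
      refine lt_of_le_of_lt (Valuation.map_sub _ _ _) (max_lt ?_ ?_)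
      · rw [map_mul]; exact mul_lt_one_of_nonneg_of_lt_one_left zero_le h00' (hΨint 1 1)
      · rw [map_mul]; exact mul_lt_one_of_nonneg_of_lt_one_left zero_le hlt (hΨint 1 0)
    rw [hΨdet] at h
    exact lt_irrefl _ h
  have hb0 : Ψ 0 1 ≠ 0 := fun h0 => by rw [h0, map_zero] at hb; exact zero_ne_one hb
  have hσb0 : σ (Ψ 0 1) ≠ 0 := fun h0 => hb0 (by rw [← map_zero σ] at h0; exact σ.injective h0)
  have hbi : Valued.v (Ψ 0 1)⁻¹ = 1 := by rw [map_inv₀, hb, inv_one]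
  have hLL : (!![(1 : K), 0; (Ψ 0 1)⁻¹, 1] : Matrix (Fin 2) (Fin 2) K) * !![(1 : K), 0; -(Ψ 0 1)⁻¹, 1] = 1 := by
    ext i j; fin_cases i <;> fin_cases j <;> simp [Matrix.mul_apply, Fin.sum_univ_two]
  have hLL' : (!![(1 : K), 0; -(Ψ 0 1)⁻¹, 1] : Matrix (Fin 2) (Fin 2) K) * !![(1 : K), 0; (Ψ 0 1)⁻¹, 1] = 1 := by
    ext i j; fin_cases i <;> fin_cases j <;> simp [Matrix.mul_apply, Fin.sum_univ_two]
  refine ⟨⟨_, _, hLL, hLL'⟩, fun i j => ?_, fun i j => ?_, ?_⟩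
  · fin_cases i <;> fin_cases j <;> simp [hb]
  · show Valued.v ((!![(1 : K), 0; -(Ψ 0 1)⁻¹, 1] : Matrix (Fin 2) (Fin 2) K) i j) ≤ 1
    fin_cases i <;> fin_cases j <;> simp [hb]
  · rw [formCongr_two_apply_zero_zero]
    have hval : ((⟨_, _, hLL, hLL'⟩ : GL (Fin 2) K) : Matrix (Fin 2) (Fin 2) K) = !![(1 : K), 0; (Ψ 0 1)⁻¹, 1] := rfl
    rw [hval]
    simp only [Matrix.of_apply, Matrix.cons_val', Matrix.cons_val_zero, Matrix.cons_val_one, Matrix.empty_val', Matrix.cons_val_fin_one,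
      map_one, one_mul, mul_one, h10]
    -- `Ψ₀₀ + b·b⁻¹ + σ(b⁻¹)·(σb + Ψ₁₁·b⁻¹) = 2 + (Ψ₀₀ + σ(b⁻¹)·Ψ₁₁·b⁻¹)`
    have e : Ψ 0 0 + Ψ 0 1 * (Ψ 0 1)⁻¹ + σ (Ψ 0 1)⁻¹ * (σ (Ψ 0 1) + Ψ 1 1 * (Ψ 0 1)⁻¹) =
        2 + (Ψ 0 0 + σ (Ψ 0 1)⁻¹ * Ψ 1 1 * (Ψ 0 1)⁻¹) := by
      rw [map_inv₀]
      field_simp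
      ring
    rw [e]
    have hsmall : Valued.v (Ψ 0 0 + σ (Ψ 0 1)⁻¹ * Ψ 1 1 * (Ψ 0 1)⁻¹) < 1 := by
      refine lt_of_le_of_lt (Valuation.map_add _ _ _) (max_lt h00' ?_)
      rw [map_mul, map_mul, hvσ, hbi, one_mul, mul_one]; exact h11'
    rw [Valuation.map_add_eq_of_lt_left _ (by rw [h2]; exact hsmall), h2]

/-- **INTEGRAL DIAGONALISATION OF A UNIMODULAR HERMITIAN PLANE** (`σ` an isometric involution, `|2| = 1`): `ᵗσ̄E·Ψ·E = diag(d)` with `E, E⁻¹` integral and the `dᵢ`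
σ-fixed units — unit pivot (`exists_isIntMatrix_formCongr_corner_unit`) then the integral shear (`formCongr_upperShear_eq_diagonal`).  Field-level twin of ★
`HermitianUnimodularRamified.exists_formCongr_eq_diagonal`. [cite: Jacobowitz1962, §8] [cite: Omeara1963, §92:1] -/
theorem exists_isIntMatrix_formCongr_eq_diagonal {σ : K →+* K} (hσ : ∀ a, σ (σ a) = a) (hvσ : ∀ a, Valued.v (σ a) = Valued.v a) (h2 : Valued.v (2 : K) = 1)
    {Ψ : Matrix (Fin 2) (Fin 2) K} (hΨh : (Ψ.map σ)ᵀ = Ψ) (hΨint : IsIntMatrix Ψ) (hΨdet : Valued.v Ψ.det = 1) :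
    ∃ (E : GL (Fin 2) K) (d : Fin 2 → K), IsIntMatrix (E : Matrix (Fin 2) (Fin 2) K) ∧ IsIntMatrix ((E⁻¹ : GL (Fin 2) K) : Matrix (Fin 2) (Fin 2) K) ∧
      formCongr σ E Ψ = Matrix.diagonal d ∧ (∀ i, Valued.v (d i) = 1) ∧ (∀ i, σ (d i) = d i) := by
  obtain ⟨E₀, hE₀, hE₀i, hcorner⟩ := exists_isIntMatrix_formCongr_corner_unit hvσ h2 hΨh hΨint hΨdet
  obtain ⟨Ψ', hΨ'def⟩ : ∃ Ψ' : Matrix (Fin 2) (Fin 2) K, Ψ' = formCongr σ E₀ Ψ := ⟨_, rfl⟩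
  rw [← hΨ'def] at hcorner
  have hΨ'h : (Ψ'.map σ)ᵀ = Ψ' := by rw [hΨ'def]; exact formCongr_hermitian σ hσ E₀ hΨh
  have hΨ'int : IsIntMatrix Ψ' := by
    rw [hΨ'def]
    exact isIntMatrix_mul (isIntMatrix_mul (isIntMatrix_transpose_map hvσ hE₀) hΨint) hE₀
  have hdetE₀ : Valued.v (E₀ : Matrix (Fin 2) (Fin 2) K).det = 1 := v_det_eq_one_of_isIntMatrix_inv hE₀ hE₀i
  have hΨ'det : Valued.v Ψ'.det = 1 := by
    rw [hΨ'def, det_formCongr_eq, map_mul, map_mul, hvσ, hΨdet, hdetE₀, one_mul, one_mul]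
  have h10 : Ψ' 1 0 = σ (Ψ' 0 1) := by
    have h := congr_fun (congr_fun hΨ'h 1) 0
    rw [Matrix.transpose_apply, Matrix.map_apply] at h
    exact h.symm
  have h00 : σ (Ψ' 0 0) = Ψ' 0 0 := by
    have h := congr_fun (congr_fun hΨ'h 0) 0
    rw [Matrix.transpose_apply, Matrix.map_apply] at h
    exact h
  have ha : Ψ' 0 0 ≠ 0 := fun h0 => by rw [h0, map_zero] at hcorner; exact zero_ne_one hcorner
  have hσdet : σ Ψ'.det = Ψ'.det := by
    have h := congrArg Matrix.det hΨ'h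
    rw [Matrix.det_transpose, ← RingHom.mapMatrix_apply, ← RingHom.map_det] at h
    exact h
  -- the integral shear
  have hLL : (!![(1 : K), -(Ψ' 0 1 / Ψ' 0 0); 0, 1] : Matrix (Fin 2) (Fin 2) K) * !![(1 : K), Ψ' 0 1 / Ψ' 0 0; 0, 1] = 1 := by
    ext i j; fin_cases i <;> fin_cases j <;> simp [Matrix.mul_apply, Fin.sum_univ_two]
  have hLL' : (!![(1 : K), Ψ' 0 1 / Ψ' 0 0; 0, 1] : Matrix (Fin 2) (Fin 2) K) * !![(1 : K), -(Ψ' 0 1 / Ψ' 0 0); 0, 1] = 1 := by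
    ext i j; fin_cases i <;> fin_cases j <;> simp [Matrix.mul_apply, Fin.sum_univ_two]
  obtain ⟨E₁, hE₁, hE₁i⟩ : ∃ E₁ : GL (Fin 2) K, (E₁ : Matrix (Fin 2) (Fin 2) K) = !![(1 : K), -(Ψ' 0 1 / Ψ' 0 0); 0, 1] ∧
      ((E₁⁻¹ : GL (Fin 2) K) : Matrix (Fin 2) (Fin 2) K) = !![(1 : K), Ψ' 0 1 / Ψ' 0 0; 0, 1] := ⟨⟨_, _, hLL, hLL'⟩, rfl, rfl⟩
  have ht2 : Valued.v (Ψ' 0 1) / Valued.v (Ψ' 0 0) ≤ 1 := by rw [hcorner, div_one]; exact hΨ'int 0 1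
  have hE₁int : IsIntMatrix (E₁ : Matrix (Fin 2) (Fin 2) K) := fun i j => by
    rw [hE₁]; fin_cases i <;> fin_cases j <;> simp [ht2]
  have hE₁iint : IsIntMatrix ((E₁⁻¹ : GL (Fin 2) K) : Matrix (Fin 2) (Fin 2) K) := fun i j => by
    rw [hE₁i]; fin_cases i <;> fin_cases j <;> simp [ht2]
  have hdiag : formCongr σ E₁ Ψ' = Matrix.diagonal ![Ψ' 0 0, Ψ'.det / Ψ' 0 0] := formCongr_upperShear_eq_diagonal σ h10 h00 ha E₁ hE₁
  refine ⟨E₀ * E₁, ![Ψ' 0 0, Ψ'.det / Ψ' 0 0], ?_, ?_, ?_, fun i => ?_, fun i => ?_⟩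
  · rw [Units.val_mul]; exact isIntMatrix_mul hE₀ hE₁int
  · rw [_root_.mul_inv_rev, Units.val_mul]; exact isIntMatrix_mul hE₁iint hE₀i
  · rw [formCongr_mul_eq_formCongr_formCongr, ← hΨ'def, hdiag]
  · fin_cases i
    · exact hcorner
    · show Valued.v (Ψ'.det / Ψ' 0 0) = 1
      rw [map_div₀, hΨ'det, hcorner, div_one]
  · fin_cases i
    · exact h00
    · show σ (Ψ'.det / Ψ' 0 0) = Ψ'.det / Ψ' 0 0
      rw [map_div₀, hσdet, h00]

/-- **`|d₀ + d₁·N(c)| = 1` for integral `c` when `−d₀d₁` is NOT a norm** (`σ` an isometric involution, `dᵢ` σ-fixed units, clause (norm) for σ-fixed principal units): otherwise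
`u := −d₀∕(d₁N(c)) ≡ 1` is a σ-fixed norm `N(z)` and `−d₀d₁ = N(z·d₁·c)`. [cite: Serre1979, Ch. V §3] [cite: LabesseLanglands1979, §2 p. 9] [cite: Jacobowitz1962, §7] -/
theorem valued_add_mul_norm_eq_one_of_not_norm {σ : K →+* K} (hσ : ∀ a, σ (σ a) = a) (hvσ : ∀ a, Valued.v (σ a) = Valued.v a)
    (hnorm : ∀ u : K, σ u = u → Valued.v (u - 1) < 1 → ∃ z : K, z * σ z = u)
    {d₀ d₁ : K} (hσ₀ : σ d₀ = d₀) (hσ₁ : σ d₁ = d₁) (h₀ : Valued.v d₀ = 1) (h₁ : Valued.v d₁ = 1)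
    (hN : ¬ ∃ t : K, t * σ t = -(d₀ * d₁)) (c : K) (hc : Valued.v c ≤ 1) : Valued.v (d₀ + d₁ * (σ c * c)) = 1 := by
  by_contra hne
  have hle : Valued.v (d₀ + d₁ * (σ c * c)) ≤ 1 := by
    refine (Valuation.map_add _ _ _).trans (max_le h₀.le ?_)
    rw [map_mul, map_mul, h₁, hvσ, one_mul]; exact mul_le_one' hc hc
  have hlt : Valued.v (d₀ + d₁ * (σ c * c)) < 1 := lt_of_le_of_ne hle hne
  -- `|d₁ N(c)| = 1`
  have hN1 : Valued.v (d₁ * (σ c * c)) = 1 := by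
    have h := Valuation.map_add_eq_of_lt_left (Valued.v) (x := -d₀) (y := d₀ + d₁ * (σ c * c)) (by rw [Valuation.map_neg, h₀]; exact hlt)
    rw [neg_add_cancel_left, Valuation.map_neg, h₀] at h
    exact h
  have hN0 : d₁ * (σ c * c) ≠ 0 := fun h0 => by rw [h0, map_zero] at hN1; exact zero_ne_one hN1
  have hd₁0 : d₁ ≠ 0 := fun h0 => hN0 (by rw [h0, zero_mul])
  have hc0 : c ≠ 0 := fun h0 => hN0 (by rw [h0, mul_zero, mul_zero])
  have hσc0 : σ c ≠ 0 := fun h0 => hN0 (by rw [h0, zero_mul, mul_zero])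
  -- `u := −d₀ ∕ (d₁ N(c))` is σ-fixed and `≡ 1`
  obtain ⟨u, hu⟩ : ∃ u : K, u = -d₀ * (d₁ * (σ c * c))⁻¹ := ⟨_, rfl⟩
  have hσu : σ u = u := by
    rw [hu, map_mul, map_neg, map_inv₀, map_mul, map_mul, hσ, hσ₀, hσ₁, mul_comm c (σ c)]
  have hu1 : Valued.v (u - 1) < 1 := by
    have e : u - 1 = -(d₀ + d₁ * (σ c * c)) * (d₁ * (σ c * c))⁻¹ := by
      rw [hu]; field_simp; ring
    rw [e, map_mul, map_inv₀, hN1, inv_one, mul_one, Valuation.map_neg]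
    exact hlt
  obtain ⟨z, hz⟩ := hnorm u hσu hu1
  refine hN ⟨z * d₁ * c, ?_⟩
  have key : u * (d₁ * d₁) * (σ c * c) = -(d₀ * d₁) := by
    rw [hu]; field_simp
  calc z * d₁ * c * σ (z * d₁ * c) = (z * σ z) * (d₁ * σ d₁) * (σ c * c) := by rw [map_mul, map_mul]; ring
    _ = u * (d₁ * d₁) * (σ c * c) := by rw [hz, hσ₁]
    _ = -(d₀ * d₁) := key

/-- **`|d₀·N(c) + d₁| = 1` for integral `c` when `−d₀d₁` is NOT a norm** (the roles of `d₀`, `d₁` exchanged in `valued_add_mul_norm_eq_one_of_not_norm`).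
[cite: Serre1979, Ch. V §3] [cite: LabesseLanglands1979, §2 p. 9] [cite: Jacobowitz1962, §7] -/
theorem valued_mul_norm_add_eq_one_of_not_norm {σ : K →+* K} (hσ : ∀ a, σ (σ a) = a) (hvσ : ∀ a, Valued.v (σ a) = Valued.v a)
    (hnorm : ∀ u : K, σ u = u → Valued.v (u - 1) < 1 → ∃ z : K, z * σ z = u)
    {d₀ d₁ : K} (hσ₀ : σ d₀ = d₀) (hσ₁ : σ d₁ = d₁) (h₀ : Valued.v d₀ = 1) (h₁ : Valued.v d₁ = 1)
    (hN : ¬ ∃ t : K, t * σ t = -(d₀ * d₁)) (c : K) (hc : Valued.v c ≤ 1) : Valued.v (d₀ * (σ c * c) + d₁) = 1 := by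
  rw [add_comm]
  exact valued_add_mul_norm_eq_one_of_not_norm hσ hvσ hnorm hσ₁ hσ₀ h₁ h₀ (by rw [mul_comm d₁ d₀]; exact hN) c hc

end ValuedField

end Literature.NumberTheory.QuadraticForms.HermitianUnimodularValued

end
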